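import Summits.CriticalPhenomena.PercolationContinuityZ3.Theorems.PercNearOneGluingNoHeavyLowerTailSahiCombTriWAndBlock3

/-!
# AND with an `x ∨ yz` block: `AndShellLower` for `Q = orAnd = {y ⊆ Fin 3 | 0 ∈ y ∨ {1,2} ⊆ y}`

Support file of the one-cut programme (crux `NoHeavyLowerTail`, stmt-CriticalPhenomena-4575; unit `prim-lf-1` gen 45, memo
`FROM-prim-lf-1-gen45-AND-OR3.md`).  Continuation of `…SahiCombTriWAndOr2` (gen 43, `Q = or2`) and `…SahiCombTriWAndProd` (gen 41, the
typed conjecture `AndShellLower`: the LOWER sandwich bound of the sectionwise Formula-A score on `andProd P₁ Q`).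
Here the lower bound is PROVED for the second non-intersecting block on three coordinates, `Q = orAnd` (the monotone function
`x₀ ∨ x₁x₂`; `S_Q = Q ∩ refl Q = {{0},{1,2}}`, `E_Q = Q \ refl Q = {{0,1},{0,2},⊤}`):
* **`lForm_le_scoreVal_andProd_orAnd`**: for every antipode-free up-set `P₁` with `Cor_{P₁} ≥ 0` on up-set pairs and all up-sets
  `A, B ⊆ 2^{γ₁ ⊕ Fin 3}`: `L_{P₁ ∧ orAnd}(A,B) ≤ Σ_B secFAScore P₁ orAnd`;
* `scoreCert_andProd_orAnd`, **`triW_nonneg_andProd_orAnd`** (`TriWIneq` for `P₁ ∧ (x_a ∨ x_b x_c)` on every index cube, every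
  intersecting Kleitman shell `P₁`), `…_of_klShell`, and the example `maj3 ∧ orAnd` (n = 6).
Proof: row decomposition `score − L = Σ_{x∈P₁} rowLowOA A B x` plus an EXACT certificate found by LP (kit job j189996 of gen 43,
re-verified symbolically): with the K-atoms `k(y,y') = [x⊔y ∈ A] − [xᶜ⊔y' ∈ A]` (`y' ⊆ y`; `FiveUpSet.kat`) and the pointwise
non-negative N-atoms `[x⊔y∈A] − [x⊔y'∈A]`, `[xᶜ⊔y∈A] − [xᶜ⊔y'∈A]` (`y' ⊆ y`; `FiveUpSet.nU`, `FiveUpSet.nW`),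
  `rowLowOA = k(0,0)k'(12,∅) + k(12,∅)k'(0,0) + k(01,1)k'(01,1) + k(02,2)k'(02,2) + k(⊤,12)k'(⊤,12) + (nine N⊗N products)`
(`rowLowOA_eq_cert`, by `ring`); the five K⊗K sums are `≥ 0` over `P₁` by acuteness (`sum_diffInd_mul_nonneg'`), the rest pointwise.
REMARK (recorded in the memo, not used here): for `Q = OR₃` NO certificate over these unit atoms exists (the LP is exactly infeasible, phase-1
optimum 1/3, even with a free pointwise remainder); OR₃ needs lattice atoms (`[x⊔y∈A] − [xᶜ⊔y₁∈A ∨ xᶜ⊔y₂∈A]`) — next file.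
HONEST LABEL: complete proofs, std axioms; `AndShellLower` for `Q = orAnd` only; the general conjecture stays OPEN. [this work]
-/

namespace Summit.CriticalPhenomena.PercolationContinuityZ3.Theorems

namespace FiveUpSet

open Finset

variable {β γ₁ : Type} [DecidableEq β] [Fintype β] [DecidableEq γ₁] [Fintype γ₁]

/-! ### The family `orAnd` (`x₀ ∨ x₁x₂`) -/

/-- `orAnd = {y ⊆ Fin 3 | 0 ∈ y ∨ (1 ∈ y ∧ 2 ∈ y)}` = `{{0}, {0,1}, {0,2}, {1,2}, ⊤}`. [this work] -/
def orAnd : Finset (Finset (Fin 3)) := univ.filter fun y => (0 : Fin 3) ∈ y ∨ ((1 : Fin 3) ∈ y ∧ (2 : Fin 3) ∈ y)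

/-- The five elements of `orAnd`. [this work] -/
theorem orAnd_eq : orAnd = {{0}, {0, 1}, {0, 2}, {1, 2}, univ} := by decide

/-- `orAnd` is an up-set. [this work] -/
theorem isUpperSet_orAnd : IsUpperSet (orAnd : Set (Finset (Fin 3))) := by
  intro y y' hyy' hy
  simp only [orAnd, coe_filter, mem_univ, true_and, Set.mem_setOf_eq] at hy ⊢
  rcases hy with h | ⟨h1, h2⟩
  · exact Or.inl (hyy' h)
  · exact Or.inr ⟨hyy' h1, hyy' h2⟩

/-- The symmetric core `orAnd ∩ refl orAnd = {{0},{1,2}}`. [this work] -/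
theorem orAnd_inter_refl : orAnd ∩ refl orAnd = {{0}, {1, 2}} := by decide

/-- The asymmetric part `orAnd \ refl orAnd = {{0,1},{0,2},⊤}`. [this work] -/
theorem orAnd_sdiff_refl : orAnd \ refl orAnd = {{0, 1}, {0, 2}, univ} := by decide

/-- `refl orAnd = {{1,2}, {2}, {1}, {0}, ∅}`. [this work] -/
theorem refl_orAnd : refl orAnd = {{1, 2}, {2}, {1}, {0}, ∅} := by decide

/-! ### Generic row atoms on a block `δ` -/

/-- K-atom `k_A(y,y')(x) = [x⊔y ∈ A] − [xᶜ⊔y' ∈ A]` (a unit K-vector when `y' ⊆ y`). [this work] -/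
def kat {δ : Type} [DecidableEq δ] (A : Finset (Finset (γ₁ ⊕ δ))) (y y' : Finset δ) (x : Finset γ₁) : ℤ :=
  ind A (x.disjSum y) - ind A (xᶜ.disjSum y')

/-- N-atom on the `x`-row: `[x⊔y ∈ A] − [x⊔y' ∈ A]` (pointwise `≥ 0` when `y' ⊆ y`). [this work] -/
def nU {δ : Type} [DecidableEq δ] (A : Finset (Finset (γ₁ ⊕ δ))) (y y' : Finset δ) (x : Finset γ₁) : ℤ :=
  ind A (x.disjSum y) - ind A (x.disjSum y')

/-- N-atom on the `xᶜ`-row: `[xᶜ⊔y ∈ A] − [xᶜ⊔y' ∈ A]` (pointwise `≥ 0` when `y' ⊆ y`). [this work] -/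
def nW {δ : Type} [DecidableEq δ] (A : Finset (Finset (γ₁ ⊕ δ))) (y y' : Finset δ) (x : Finset γ₁) : ℤ :=
  ind A (xᶜ.disjSum y) - ind A (xᶜ.disjSum y')

omit [Fintype γ₁] in
/-- `nU ≥ 0` for `y' ⊆ y`. [this work] -/
theorem nU_nonneg {δ : Type} [DecidableEq δ] {A : Finset (Finset (γ₁ ⊕ δ))} (hA : IsUpperSet (A : Set (Finset (γ₁ ⊕ δ)))) {y y' : Finset δ}
    (h : y' ⊆ y) (x : Finset γ₁) : 0 ≤ nU A y y' x := by
  unfold nU; linarith [ind_mono_pt hA (disjSum_mono (le_refl x) h)]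

/-- `nW ≥ 0` for `y' ⊆ y`. [this work] -/
theorem nW_nonneg {δ : Type} [DecidableEq δ] {A : Finset (Finset (γ₁ ⊕ δ))} (hA : IsUpperSet (A : Set (Finset (γ₁ ⊕ δ)))) {y y' : Finset δ}
    (h : y' ⊆ y) (x : Finset γ₁) : 0 ≤ nW A y y' x := by
  unfold nW; linarith [ind_mono_pt hA (disjSum_mono (le_refl xᶜ) h)]

section acute
variable {P₁ : Finset (Finset γ₁)} (hP : IsUpperSet (P₁ : Set (Finset γ₁))) (hd : Disjoint P₁ (refl P₁))
  (hcor : ∀ U V : Finset (Finset γ₁), IsUpperSet (U : Set (Finset γ₁)) → IsUpperSet (V : Set (Finset γ₁)) → 0 ≤ corP P₁ U V)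
include hP hd hcor

/-- Acuteness of two K-atoms over an intersecting Kleitman shell `P₁`. [this work] -/
theorem sum_kat_mul_kat_nonneg {δ : Type} [DecidableEq δ] {A B : Finset (Finset (γ₁ ⊕ δ))} (hA : IsUpperSet (A : Set (Finset (γ₁ ⊕ δ))))
    (hB : IsUpperSet (B : Set (Finset (γ₁ ⊕ δ)))) {y y' z z' : Finset δ} (hyy : y' ⊆ y) (hzz : z' ⊆ z) :
    0 ≤ ∑ x ∈ P₁, kat A y y' x * kat B z z' x := by
  unfold kat; exact sum_diffInd_mul_nonneg' hP hd hcor hA hB hyy hzz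

end acute

/-! ### The row defect of `P₁ ∧ orAnd` and its certificate -/

/-- The row defect of the sectionwise Formula-A score on `P₁ ∧ orAnd` (per `x`): `Σ_{y∈E} δδ' + d₀D₁₂ + d₁₂D₀ + ee'`. [this work] -/
def rowLowOA (A B : Finset (Finset (γ₁ ⊕ Fin 3))) (x : Finset γ₁) : ℤ :=
  kat A {0, 1} {2} x * kat B {0, 1} {2} x + kat A {0, 2} {1} x * kat B {0, 2} {1} x + kat A univ ∅ x * kat B univ ∅ x
    + kat A {0} {0} x * kat B {1, 2} {1, 2} x + kat A {1, 2} {1, 2} x * kat B {0} {0} x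
    + (ind A (xᶜ.disjSum {0}) - ind A (xᶜ.disjSum {1, 2})) * (ind B (xᶜ.disjSum {0}) - ind B (xᶜ.disjSum {1, 2}))

/-- **The certificate identity** for one row of `P₁ ∧ orAnd` (five K⊗K products, nine N⊗N products). [this work] -/
theorem rowLowOA_eq_cert (A B : Finset (Finset (γ₁ ⊕ Fin 3))) (x : Finset γ₁) :
    rowLowOA A B x
      = kat A {0} {0} x * kat B {1, 2} ∅ x + kat A {1, 2} ∅ x * kat B {0} {0} x + kat A {0, 1} {1} x * kat B {0, 1} {1} x
        + kat A {0, 2} {2} x * kat B {0, 2} {2} x + kat A univ {1, 2} x * kat B univ {1, 2} x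
        + nW A {0} ∅ x * nW B {0} ∅ x + nW A {1} ∅ x * nU B {0, 1} {0} x + nW A {2} ∅ x * nU B univ {0, 1} x
        + nU A {0, 1} {0} x * nW B {1, 2} {2} x + nU A {0, 2} {0} x * nW B {2} ∅ x + nW A {1, 2} {1} x * nU B {0, 2} {0} x
        + nU A univ {0, 1} x * nW B {1, 2} {1} x + nW A {1, 2} {2} x * nU B univ {0, 2} x + nU A univ {0, 2} x * nW B {1} ∅ x := by
  unfold rowLowOA kat nU nW; ring

/-! ### The row decomposition of `score − L` -/

omit [Fintype γ₁] in
/-- The score row of `P₁ ∧ orAnd`: `#(S ∩ B_x ∩ refl A_x) + #(E ∩ A_x ∩ B_x)` as an indicator polynomial. [this work] -/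
theorem score_rowOA (A B : Finset (Finset (γ₁ ⊕ Fin 3))) (x : Finset γ₁) :
    (((orAnd ∩ refl orAnd ∩ secR B x ∩ refl (secR A x)).card : ℤ) + ((orAnd \ refl orAnd) ∩ secR A x ∩ secR B x).card)
      = ind B (x.disjSum {0}) * ind A (x.disjSum {1, 2}) + ind B (x.disjSum {1, 2}) * ind A (x.disjSum {0})
        + (ind A (x.disjSum {0, 1}) * ind B (x.disjSum {0, 1}) + ind A (x.disjSum {0, 2}) * ind B (x.disjSum {0, 2})
          + ind A (x.disjSum univ) * ind B (x.disjSum univ)) := by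
  rw [orAnd_inter_refl, orAnd_sdiff_refl, card_pair_inter_inter (by decide), card_triple_inter_inter (by decide) (by decide) (by decide),
    ind_refl, ind_refl, compl_fin3_0, compl_fin3_12]
  simp only [ind_secR]

/-- First `L`-row: `#(orAnd ∩ (refl A)_x ∩ B_x)`. [this work] -/
theorem lrowOA₁ (A B : Finset (Finset (γ₁ ⊕ Fin 3))) (x : Finset γ₁) :
    ((orAnd ∩ secR (refl A) x ∩ secR B x).card : ℤ)
      = ind A (xᶜ.disjSum {1, 2}) * ind B (x.disjSum {0}) + ind A (xᶜ.disjSum {2}) * ind B (x.disjSum {0, 1})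
        + ind A (xᶜ.disjSum {1}) * ind B (x.disjSum {0, 2}) + ind A (xᶜ.disjSum {0}) * ind B (x.disjSum {1, 2})
        + ind A (xᶜ.disjSum ∅) * ind B (x.disjSum univ) := by
  rw [card_inter_inter_eq_sum_ind', orAnd_eq, sum_insert (by decide), sum_insert (by decide), sum_insert (by decide),
    sum_insert (by decide), sum_singleton, secR_refl]
  simp only [ind_refl, ind_secR, compl_fin3_0, compl_fin3_01, compl_fin3_02, compl_fin3_12, compl_univ]
  ring

/-- Second `L`-row: `#(orAnd ∩ A_x ∩ (refl B)_x)`. [this work] -/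
theorem lrowOA₂ (A B : Finset (Finset (γ₁ ⊕ Fin 3))) (x : Finset γ₁) :
    ((orAnd ∩ secR A x ∩ secR (refl B) x).card : ℤ)
      = ind A (x.disjSum {0}) * ind B (xᶜ.disjSum {1, 2}) + ind A (x.disjSum {0, 1}) * ind B (xᶜ.disjSum {2})
        + ind A (x.disjSum {0, 2}) * ind B (xᶜ.disjSum {1}) + ind A (x.disjSum {1, 2}) * ind B (xᶜ.disjSum {0})
        + ind A (x.disjSum univ) * ind B (xᶜ.disjSum ∅) := by
  rw [card_inter_inter_eq_sum_ind', orAnd_eq, sum_insert (by decide), sum_insert (by decide), sum_insert (by decide),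
    sum_insert (by decide), sum_singleton, secR_refl]
  simp only [ind_refl, ind_secR, compl_fin3_0, compl_fin3_01, compl_fin3_02, compl_fin3_12, compl_univ]
  ring

/-- Third `L`-row (antipodal rows): `#(refl orAnd ∩ A_{xᶜ} ∩ B_{xᶜ})`. [this work] -/
theorem lrowOA₃ (A B : Finset (Finset (γ₁ ⊕ Fin 3))) (x : Finset γ₁) :
    ((refl orAnd ∩ secR A xᶜ ∩ secR B xᶜ).card : ℤ)
      = ind A (xᶜ.disjSum {1, 2}) * ind B (xᶜ.disjSum {1, 2}) + ind A (xᶜ.disjSum {2}) * ind B (xᶜ.disjSum {2})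
        + ind A (xᶜ.disjSum {1}) * ind B (xᶜ.disjSum {1}) + ind A (xᶜ.disjSum {0}) * ind B (xᶜ.disjSum {0})
        + ind A (xᶜ.disjSum ∅) * ind B (xᶜ.disjSum ∅) := by
  rw [card_inter_inter_eq_sum_ind', refl_orAnd, sum_insert (by decide), sum_insert (by decide), sum_insert (by decide),
    sum_insert (by decide), sum_singleton]
  simp only [ind_secR]
  ring

/-- **Row decomposition**: `Σ_B secFAScore − L_{P₁ ∧ orAnd}(A,B) = Σ_{x∈P₁} rowLowOA A B x`. [this work] -/
theorem scoreVal_sub_lForm_andProd_orAnd (P₁ : Finset (Finset γ₁)) (A B : Finset (Finset (γ₁ ⊕ Fin 3))) :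
    scoreVal (secFAScore P₁ orAnd) A B - lForm (andProd P₁ orAnd) A B = ∑ x ∈ P₁, rowLowOA A B x := by
  rw [scoreVal_secFAScore]
  unfold lForm
  rw [card_andProd_inter_inter, card_andProd_inter_inter, refl_andProd, card_andProd_inter_inter, sum_refl_eq]
  rw [← sum_add_distrib, ← sum_sub_distrib, ← sum_sub_distrib]
  refine sum_congr rfl fun x _ => ?_
  rw [score_rowOA, lrowOA₁, lrowOA₂, lrowOA₃]
  unfold rowLowOA kat
  ring

/-! ### The theorem -/

section main
variable {P₁ : Finset (Finset γ₁)} (hP : IsUpperSet (P₁ : Set (Finset γ₁))) (hd : Disjoint P₁ (refl P₁))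
  (hcor : ∀ U V : Finset (Finset γ₁), IsUpperSet (U : Set (Finset γ₁)) → IsUpperSet (V : Set (Finset γ₁)) → 0 ≤ corP P₁ U V)
include hP hd hcor

/-- **THEOREM (`AndShellLower` for `Q = orAnd`).**  For every antipode-free up-set `P₁` with `Cor_{P₁} ≥ 0` on up-set pairs and all
up-sets `A, B`: `L_{P₁ ∧ orAnd}(A,B) ≤ Σ_B secFAScore P₁ orAnd`. [this work] -/
theorem lForm_le_scoreVal_andProd_orAnd {A B : Finset (Finset (γ₁ ⊕ Fin 3))} (hA : IsUpperSet (A : Set (Finset (γ₁ ⊕ Fin 3))))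
    (hB : IsUpperSet (B : Set (Finset (γ₁ ⊕ Fin 3)))) :
    lForm (andProd P₁ orAnd) A B ≤ scoreVal (secFAScore P₁ orAnd) A B := by
  suffices h : 0 ≤ scoreVal (secFAScore P₁ orAnd) A B - lForm (andProd P₁ orAnd) A B by linarith
  rw [scoreVal_sub_lForm_andProd_orAnd, sum_congr rfl fun x _ => rowLowOA_eq_cert A B x]
  simp only [sum_add_distrib]
  have k1 : 0 ≤ ∑ x ∈ P₁, kat A {0} {0} x * kat B {1, 2} ∅ x := sum_kat_mul_kat_nonneg hP hd hcor hA hB Subset.rfl (empty_subset _)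
  have k2 : 0 ≤ ∑ x ∈ P₁, kat A {1, 2} ∅ x * kat B {0} {0} x := sum_kat_mul_kat_nonneg hP hd hcor hA hB (empty_subset _) Subset.rfl
  have k3 : 0 ≤ ∑ x ∈ P₁, kat A {0, 1} {1} x * kat B {0, 1} {1} x := sum_kat_mul_kat_nonneg hP hd hcor hA hB (by decide) (by decide)
  have k4 : 0 ≤ ∑ x ∈ P₁, kat A {0, 2} {2} x * kat B {0, 2} {2} x := sum_kat_mul_kat_nonneg hP hd hcor hA hB (by decide) (by decide)
  have k5 : 0 ≤ ∑ x ∈ P₁, kat A univ {1, 2} x * kat B univ {1, 2} x :=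
    sum_kat_mul_kat_nonneg hP hd hcor hA hB (subset_univ _) (subset_univ _)
  have n1 : 0 ≤ ∑ x ∈ P₁, nW A {0} ∅ x * nW B {0} ∅ x :=
    sum_nonneg fun x _ => mul_nonneg (nW_nonneg hA (empty_subset _) x) (nW_nonneg hB (empty_subset _) x)
  have n2 : 0 ≤ ∑ x ∈ P₁, nW A {1} ∅ x * nU B {0, 1} {0} x :=
    sum_nonneg fun x _ => mul_nonneg (nW_nonneg hA (empty_subset _) x) (nU_nonneg hB (by decide) x)
  have n3 : 0 ≤ ∑ x ∈ P₁, nW A {2} ∅ x * nU B univ {0, 1} x :=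
    sum_nonneg fun x _ => mul_nonneg (nW_nonneg hA (empty_subset _) x) (nU_nonneg hB (subset_univ _) x)
  have n4 : 0 ≤ ∑ x ∈ P₁, nU A {0, 1} {0} x * nW B {1, 2} {2} x :=
    sum_nonneg fun x _ => mul_nonneg (nU_nonneg hA (by decide) x) (nW_nonneg hB (by decide) x)
  have n5 : 0 ≤ ∑ x ∈ P₁, nU A {0, 2} {0} x * nW B {2} ∅ x :=
    sum_nonneg fun x _ => mul_nonneg (nU_nonneg hA (by decide) x) (nW_nonneg hB (empty_subset _) x)
  have n6 : 0 ≤ ∑ x ∈ P₁, nW A {1, 2} {1} x * nU B {0, 2} {0} x :=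
    sum_nonneg fun x _ => mul_nonneg (nW_nonneg hA (by decide) x) (nU_nonneg hB (by decide) x)
  have n7 : 0 ≤ ∑ x ∈ P₁, nU A univ {0, 1} x * nW B {1, 2} {1} x :=
    sum_nonneg fun x _ => mul_nonneg (nU_nonneg hA (subset_univ _) x) (nW_nonneg hB (by decide) x)
  have n8 : 0 ≤ ∑ x ∈ P₁, nW A {1, 2} {2} x * nU B univ {0, 2} x :=
    sum_nonneg fun x _ => mul_nonneg (nW_nonneg hA (by decide) x) (nU_nonneg hB (subset_univ _) x)
  have n9 : 0 ≤ ∑ x ∈ P₁, nU A univ {0, 2} x * nW B {1} ∅ x :=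
    sum_nonneg fun x _ => mul_nonneg (nU_nonneg hA (subset_univ _) x) (nW_nonneg hB (empty_subset _) x)
  linarith

/-- The sectionwise Formula-A score is a score certificate for `P₁ ∧ orAnd`. [this work] -/
theorem scoreCert_andProd_orAnd : ScoreCert (andProd P₁ orAnd) (secFAScore P₁ orAnd) := fun _ _ hA hB =>
  ⟨lForm_le_scoreVal_andProd_orAnd hP hd hcor hA hB, scoreVal_secFAScore_le_uForm hP isUpperSet_orAnd hA hB⟩

/-- **`TriWIneq` for `P₁ ∧ (x_a ∨ x_b x_c)`** on every index cube, for every intersecting Kleitman shell `P₁`. [this work] -/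
theorem triW_nonneg_andProd_orAnd (F G : Finset β → Finset (Finset (γ₁ ⊕ Fin 3)))
    (hF : ∀ x, IsUpperSet (F x : Set (Finset (γ₁ ⊕ Fin 3)))) (hG : ∀ x, IsUpperSet (G x : Set (Finset (γ₁ ⊕ Fin 3))))
    (hFm : Monotone F) (hGm : Monotone G) :
    0 ≤ triW (andProd P₁ orAnd) F G :=
  triW_nonneg_of_scoreCert (monoScore_secFAScore P₁ orAnd) (scoreCert_andProd_orAnd hP hd hcor) F G hF hG hFm hGm

end main

/-- The same with the hypothesis on `P₁` in Kleitman-shell form. [this work] -/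
theorem triW_nonneg_andProd_orAnd_of_klShell {P₁ : Finset (Finset γ₁)} (hP : IsUpperSet (P₁ : Set (Finset γ₁)))
    (hd : Disjoint P₁ (refl P₁)) (hs : KlShell (P₁ ∪ refl P₁)) (F G : Finset β → Finset (Finset (γ₁ ⊕ Fin 3)))
    (hF : ∀ x, IsUpperSet (F x : Set (Finset (γ₁ ⊕ Fin 3)))) (hG : ∀ x, IsUpperSet (G x : Set (Finset (γ₁ ⊕ Fin 3))))
    (hFm : Monotone F) (hGm : Monotone G) :
    0 ≤ triW (andProd P₁ orAnd) F G :=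
  triW_nonneg_andProd_orAnd hP hd (fun U V hU hV => by rw [corP_eq_card_sub_card_of_disjoint hd]; exact hs U V hU hV) F G hF hG hFm hGm

/-- Example: `maj3 ∧ orAnd` = `maj(x,y,z) · (a ∨ bc)` (n = 6). [this work] -/
theorem triW_nonneg_maj3_andProd_orAnd (F G : Finset β → Finset (Finset (Fin 3 ⊕ Fin 3)))
    (hF : ∀ x, IsUpperSet (F x : Set (Finset (Fin 3 ⊕ Fin 3)))) (hG : ∀ x, IsUpperSet (G x : Set (Finset (Fin 3 ⊕ Fin 3))))
    (hFm : Monotone F) (hGm : Monotone G) :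
    0 ≤ triW (andProd maj3 orAnd) F G :=
  triW_nonneg_andProd_orAnd isUpperSet_maj3 disjoint_maj3_refl (fun _ _ hU hV => corP_nonneg_of_selfDual maj3_selfDual hU hV)
    F G hF hG hFm hGm

end FiveUpSet

end Summit.CriticalPhenomena.PercolationContinuityZ3.Theorems
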